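import Summits.HodgeConjecture.CorCM.GaloisDodecicSimpleCMSixfolds
import Summits.HodgeConjecture.CorCM.OcticCMFieldAutomorphismsNondegenerate
import Literature.AlgebraicGeometry.ComplexMultiplication.EndomorphismFieldNondegenerateType
import Literature.NumberTheory.ComplexMultiplication.ShimuraTaniyamaHecke
import Summits.HodgeConjecture.HodgeConjecture.Theorems.Ring2ClassTargets
import HarnessLib

/-!
# Abelian varieties of dimension `≤ 6` with a CM field of degree `2 dim` in `End⁰`: ALL of them are stably
# nondegenerate (Galois octic resp. non-abelian/cyclic Galois dodecic field) — no simplicity hypothesis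

COR-CM (cell `pub-hodgecm2`), binder seat b04 (gen 21), count-neutral claim SMALL-DEGREE-ALLTYPES (companion of
DICYCLIC-ALLTYPES / CYCLIC-ALLTYPES).  KERNEL ONLY: theorems; no definition, no named fact, no `sorry`.  `HC_CM` is
neither used nor claimed: this is the Hodge conjecture for a NAMED CLASS of abelian varieties, UNCONDITIONALLY.

Gens 13–14 (`GaloisOcticSimpleCMFourfolds`, `OcticCMFieldAutomorphismsNondegenerate`, `GaloisDodecicSimpleCMSixfolds`)
prove that every PRIMITIVE CM type of a CM field `F` of degree `[F:ℚ] ≤ 12` is nondegenerate provided `F/ℚ` is Galois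
(or merely `|Aut(F)| > 2`) when `[F:ℚ] = 8` and `F/ℚ` is Galois with non-abelian or cyclic group when `[F:ℚ] = 12`
(`isNondegenerate_of_isPrimitive_of_finrank_le_twelve`; degrees `≤ 6` and `10` by Ribet and Tankeev–Ribet–Yanai);
hence the Hodge conjecture for all powers of the SIMPLE abelian varieties with CM by such fields.  Here the simplicity
hypothesis is REMOVED, by lit-hodgefound's primitive-core engine (`EndFieldFullDegree.isStablyNondegenerate_of_not_
isSimple`: a NON-simple `X` with a field of degree `2 dim X` in `End⁰` is isogenous to a power `B₁ʰ`, `h ≥ 2`, of the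
simple variety of record of the primitive core of THE type, of dimension a PROPER divisor of `dim X ≤ 6`, i.e. `≤ 3` —
Ribet's bound) and Shimura's «`X` simple ⟺ THE type primitive» (`isSimple_iff_primitive_cmTypeOfPair`).

* §1 **`isStablyNondegenerate_of_finrank_le_twelve`** — `[F:ℚ] = 2 dim X ≤ 12`, with the two provisos: EVERY such
  `X` is stably nondegenerate; the variants `…_of_two_lt_card` (octic, `|Aut(F)| > 2`) and
  `…_of_forall_quadratic_isReal` (dodecic, no imaginary quadratic subfield, no Galois hypothesis);
  HC for all powers and everything isogenous to a power; realisation forms.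
* §2 `HCOnClass` displays.

## References

* [Ribet1980] K. A. Ribet, *Division fields of abelian varieties with complex multiplication*, Mém. SMF 2 (1980), §3
  Examples (3.7) (p. 87).
* [Dodson1984] B. Dodson, *The structure of Galois groups of CM-fields*, Trans. AMS 283 (1984), §3.3.2 Theorem (p. 16),
  §4 (p. 18).
* [Shimura1998] G. Shimura, *Abelian Varieties with Complex Multiplication and Modular Functions* (1998), §5.1 Prop. 3,
  §8.2 Prop. 26.
* [Gordon1999HodgeAVSurvey] B. B. Gordon, *A survey of the Hodge conjecture for abelian varieties*, 5.13, Thm. 6.3–6.4,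
  Def. 7.6.
* [MoonenZarhin1999LowDim] B. Moonen, Yu. Zarhin, *Hodge classes on abelian varieties of low dimension*, Math. Ann.
  315 (1999), Thm. 0.1, §2 condition (D).
-/

noncomputable section

open CategoryTheory CategoryTheory.Limits NumberField

namespace Summit.HodgeConjecture.CorCM.SmallDegreeAllTypes

open Literature.NumberTheory.ComplexMultiplication
open Literature.AlgebraicGeometry Literature.AlgebraicGeometry.Motives Literature.AlgebraicGeometry.HodgeTheory
open Literature.AlgebraicGeometry.Motives.AbelianVariety
open Literature.AlgebraicGeometry.ComplexMultiplication
open Literature.AlgebraicGeometry.Pohlmann1968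
open Summit.HodgeConjecture.HodgeConjecture.Ring2.ClassTargets

variable {F : Type} [Field F] [NumberField F] [IsCMField F]

/-! ## §1 All abelian varieties of dimension `≤ 6` with a CM field of full degree in `End⁰` -/

section Geometry

/-- A proper divisor of a number `≤ 6` is `≤ 3`. [folklore] -/
private theorem le_three_of_dvd_of_lt {d g : ℕ} (hg : g ≤ 6) (hd : d ∣ g) (hlt : d < g) : d ≤ 3 := by
  obtain ⟨k, rfl⟩ := hd
  rcases Nat.lt_or_ge k 2 with hk | hk
  · interval_cases k <;> omega
  · nlinarith

omit [IsCMField F] in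
/-- **The non-simple case needs no hypothesis on `F`**: a NON-simple complex abelian variety of dimension `≤ 6` with a
CM field of degree `2 dim X` in `End⁰(X)` is stably nondegenerate (it is isogenous to `B₁ʰ`, `h ≥ 2`, `dim B₁ ≤ 3`;
Ribet's bound). [cite: Ribet1980, §3 Examples (3.7) (p. 87)] [cite: Shimura1998, §5.1 Prop. 3] -/
theorem isStablyNondegenerate_of_not_isSimple_of_dim_le_six {X : AbelianVariety ℂ} (φ : F →+* X.endAlgebra)
    (hF : Module.finrank ℚ F = 2 * X.dim) (h6 : X.dim ≤ 6) (hns : ¬ X.IsSimple) : IsStablyNondegenerate X :=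
  EndFieldFullDegree.isStablyNondegenerate_of_not_isSimple φ hF hns fun _ hd hlt =>
    Or.inl (le_three_of_dvd_of_lt h6 hd hlt)

/-- **THEOREM (ALL TYPES, degree `≤ 12`).  Let `F` be a CM field with `[F:ℚ] ≤ 12`, Galois over `ℚ` if `[F:ℚ] = 8`,
and Galois with non-abelian or cyclic group if `[F:ℚ] = 12`.  Then EVERY complex abelian variety `X` with
`φ : F →+* End⁰(X)` and `[F:ℚ] = 2 dim X` — simple or not, of any CM type — is STABLY NONDEGENERATE** (`B = D` on all
powers): simple `X` ⟺ THE type primitive (Shimura §8.2 Prop. 26) ⟹ nondegenerate (gens 13–14); non-simple `X` by the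
primitive core of dimension `≤ 3`. UNCONDITIONAL. [cite: Dodson1984, §3.3.2 Theorem (p. 16), §4 (p. 18)]
[cite: Ribet1980, §3 Examples (3.7) (p. 87)] [cite: Gordon1999HodgeAVSurvey, Thm. 6.4 and Def. 7.6] -/
theorem isStablyNondegenerate_of_finrank_le_twelve (h12 : Module.finrank ℚ F ≤ 12)
    (hGal8 : Module.finrank ℚ F = 8 → IsGalois ℚ F)
    (hGal12 : Module.finrank ℚ F = 12 →
      IsGalois ℚ F ∧ ((∃ x y : F ≃ₐ[ℚ] F, x * y ≠ y * x) ∨ IsCyclic (F ≃ₐ[ℚ] F)))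
    {X : AbelianVariety ℂ} (φ : F →+* X.endAlgebra) (hF : Module.finrank ℚ F = 2 * X.dim) :
    IsStablyNondegenerate X := by
  by_cases hs : X.IsSimple
  · obtain ⟨φ₀⟩ := (inferInstance : Nonempty (F →+* ℂ))
    have hprim := (isPrimitive_ringEquiv_complex_iff _ φ₀).2
      ((EndFieldFullDegree.isSimple_iff_primitive_cmTypeOfPair φ hF).1 hs)
    exact EndFieldFullDegree.isStablyNondegenerate_of_isNondegenerate_cmTypeOfPair φ hF
      (GaloisDodecic.isNondegenerate_of_isPrimitive_of_finrank_le_twelve h12 hGal8 hGal12 φ₀ hprim)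
  · exact isStablyNondegenerate_of_not_isSimple_of_dim_le_six φ hF (by omega) hs

/-- **Octic variant with `|Aut(F)| > 2`** (no Galois hypothesis; e.g. `F = F⁺k` with `F⁺` a `D₄`-quartic): every
abelian FOURFOLD `X` with `φ : F →+* End⁰(X)`, `[F:ℚ] = 8`, is stably nondegenerate.  (Sharp: Mumford's degenerate
simple CM fourfolds have `|Aut(F)| = 2`.) [cite: Dodson1984, §3.3.2 Theorem (p. 16)] [cite: Gordon1999HodgeAVSurvey, 5.13 and Thm. 6.4] -/
theorem isStablyNondegenerate_of_two_lt_card (h8 : Module.finrank ℚ F = 8) (hA : 2 < Nat.card (F ≃ₐ[ℚ] F))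
    {X : AbelianVariety ℂ} (φ : F →+* X.endAlgebra) (hF : Module.finrank ℚ F = 2 * X.dim) :
    IsStablyNondegenerate X := by
  by_cases hs : X.IsSimple
  · obtain ⟨φ₀⟩ := (inferInstance : Nonempty (F →+* ℂ))
    have hprim := (isPrimitive_ringEquiv_complex_iff _ φ₀).2
      ((EndFieldFullDegree.isSimple_iff_primitive_cmTypeOfPair φ hF).1 hs)
    exact EndFieldFullDegree.isStablyNondegenerate_of_isNondegenerate_cmTypeOfPair φ hF
      (GaloisOctic.isNondegenerate_of_isPrimitive_of_two_lt_card h8 φ₀ hprim hA)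
  · exact isStablyNondegenerate_of_not_isSimple_of_dim_le_six φ hF (by omega) hs

/-- **Dodecic variant without Galois hypothesis**: if every quadratic subfield of the CM field `F` of degree `12` is
real, every abelian SIXFOLD `X` with `φ : F →+* End⁰(X)` is stably nondegenerate. [cite: MoonenZarhin1999LowDim, Thm. 0.1]
[cite: Gordon1999HodgeAVSurvey, 5.13 and Thm. 6.4] -/
theorem isStablyNondegenerate_of_forall_quadratic_isReal (hF12 : Module.finrank ℚ F = 12)
    (hreal : ∀ k : IntermediateField ℚ F, Module.finrank ℚ k = 2 → ∀ τ : k →+* ℂ, ComplexEmbedding.conjugate τ = τ)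
    {X : AbelianVariety ℂ} (φ : F →+* X.endAlgebra) (hF : Module.finrank ℚ F = 2 * X.dim) :
    IsStablyNondegenerate X := by
  by_cases hs : X.IsSimple
  · obtain ⟨φ₀⟩ := (inferInstance : Nonempty (F →+* ℂ))
    have hprim := (isPrimitive_ringEquiv_complex_iff _ φ₀).2
      ((EndFieldFullDegree.isSimple_iff_primitive_cmTypeOfPair φ hF).1 hs)
    exact EndFieldFullDegree.isStablyNondegenerate_of_isNondegenerate_cmTypeOfPair φ hF
      (GaloisDodecic.isNondegenerate_of_isPrimitive_of_forall_quadratic_isReal hF12 hreal φ₀ hprim)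
  · exact isStablyNondegenerate_of_not_isSimple_of_dim_le_six φ hF (by omega) hs

/-- **The Hodge conjecture for everything isogenous to a power of such an `X`** (`[F:ℚ] ≤ 12` with the two provisos).
UNCONDITIONAL. [cite: Gordon1999HodgeAVSurvey, Thm. 6.3–6.4] [cite: vanGeemen1994HodgeAV, Lemma 3.7] -/
theorem hodgeConjectureFor_of_isIsogenous_powSucc_of_finrank_le_twelve (h12 : Module.finrank ℚ F ≤ 12)
    (hGal8 : Module.finrank ℚ F = 8 → IsGalois ℚ F)
    (hGal12 : Module.finrank ℚ F = 12 →
      IsGalois ℚ F ∧ ((∃ x y : F ≃ₐ[ℚ] F, x * y ≠ y * x) ∨ IsCyclic (F ≃ₐ[ℚ] F)))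
    {X : AbelianVariety ℂ} (φ : F →+* X.endAlgebra) (hF : Module.finrank ℚ F = 2 * X.dim) {B : AbelianVariety ℂ}
    {N : ℕ} (h : IsIsogenous B (X.powSucc N)) : HodgeConjectureFor B.dim B.X :=
  (isStablyNondegenerate_of_finrank_le_twelve h12 hGal8 hGal12 φ hF).hodgeConjectureFor_of_isIsogenous_powSucc h

/-- **Galois octic CM fields: the Hodge conjecture for every power of EVERY abelian fourfold `X` with
`F ↪ End⁰(X)`** (gen 13's `hodgeConjectureFor_pow_of_isSimple_of_isGalois_eight` without simplicity).
[cite: Dodson1984, §3.3.2 Theorem (p. 16)] [cite: Gordon1999HodgeAVSurvey, 5.13 and Thm. 6.4] -/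
theorem hodgeConjectureFor_powSucc_of_isGalois_eight [IsGalois ℚ F] (h8 : Module.finrank ℚ F = 8)
    {X : AbelianVariety ℂ} (φ : F →+* X.endAlgebra) (hF : Module.finrank ℚ F = 2 * X.dim) (N : ℕ) :
    HodgeConjectureFor (X.powSucc N).dim (X.powSucc N).X :=
  (isStablyNondegenerate_of_finrank_le_twelve (by omega) (fun _ => inferInstance) (fun h => by omega) φ
    hF).hodgeConjectureFor_powSucc N

/-- **Galois dodecic CM fields with non-abelian or cyclic group: the Hodge conjecture for every power of EVERY abelian
sixfold `X` with `F ↪ End⁰(X)`** (gen 14's `hodgeConjectureFor_pow_of_isSimple_of_isGalois_twelve` without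
simplicity). [cite: Dodson1984, §4 (p. 18) and §5.3] [cite: Gordon1999HodgeAVSurvey, Thm. 6.4] -/
theorem hodgeConjectureFor_powSucc_of_isGalois_twelve [IsGalois ℚ F] (hF12 : Module.finrank ℚ F = 12)
    (hG : (∃ x y : F ≃ₐ[ℚ] F, x * y ≠ y * x) ∨ IsCyclic (F ≃ₐ[ℚ] F))
    {X : AbelianVariety ℂ} (φ : F →+* X.endAlgebra) (hF : Module.finrank ℚ F = 2 * X.dim) (N : ℕ) :
    HodgeConjectureFor (X.powSucc N).dim (X.powSucc N).X :=
  (isStablyNondegenerate_of_finrank_le_twelve (by omega) (fun h => by omega) (fun _ => ⟨inferInstance, hG⟩) φ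
    hF).hodgeConjectureFor_powSucc N

variable {Φ : CMType F} {A : AbelianVariety ℂ} {ι : 𝓞 F →+* End A} {θ : F →+* Module.End ℂ (complexBetti A.X 1)}

/-- **Realisation form**: every abelian variety `(A, ι)` of ANY CM type `(F; Φ)`, `[F:ℚ] ≤ 12` with the two provisos,
is stably nondegenerate. [cite: Gordon1999HodgeAVSurvey, Thm. 6.4 and Def. 7.6] [cite: Shimura1998, §5.1–5.2] -/
theorem isStablyNondegenerate_of_isCMTypeRealisation_of_finrank_le_twelve (h12 : Module.finrank ℚ F ≤ 12)
    (hGal8 : Module.finrank ℚ F = 8 → IsGalois ℚ F)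
    (hGal12 : Module.finrank ℚ F = 12 →
      IsGalois ℚ F ∧ ((∃ x y : F ≃ₐ[ℚ] F, x * y ≠ y * x) ∨ IsCyclic (F ≃ₐ[ℚ] F)))
    (hA : IsCMTypeRealisation Φ A ι θ) : IsStablyNondegenerate A := by
  obtain ⟨i, -⟩ := exists_ringHom_endAlgebra ι
  exact isStablyNondegenerate_of_finrank_le_twelve h12 hGal8 hGal12 i (finrank_eq_two_mul_dim_of_isCMTypeRealisation hA)

/-- **The Hodge conjecture for every power `⨁_{Fin N} A` of every abelian variety with CM by such a field** — gens
13–14's `…_pow_of_isSimple_…` without `A.IsSimple`. [cite: Gordon1999HodgeAVSurvey, Thm. 6.4] -/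
theorem hodgeConjectureFor_pow_of_finrank_le_twelve (h12 : Module.finrank ℚ F ≤ 12)
    (hGal8 : Module.finrank ℚ F = 8 → IsGalois ℚ F)
    (hGal12 : Module.finrank ℚ F = 12 →
      IsGalois ℚ F ∧ ((∃ x y : F ≃ₐ[ℚ] F, x * y ≠ y * x) ∨ IsCyclic (F ≃ₐ[ℚ] F)))
    (hA : IsCMTypeRealisation Φ A ι θ) (N : ℕ) :
    HodgeConjectureFor (⨁ fun _ : Fin N => A).dim (⨁ fun _ : Fin N => A).X :=
  hodgeConjectureFor_of_isDivisorGenerated _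
    ((isStablyNondegenerate_iff_forall_isDivisorGenerated_biproduct A).1
      (isStablyNondegenerate_of_isCMTypeRealisation_of_finrank_le_twelve h12 hGal8 hGal12 hA) N)

end Geometry

/-! ## §2 Class-target displays -/

/-- **HC on the class «isogenous to a power of an abelian variety `X` with a CM field `F ↪ End⁰(X)` of degree
`2 dim X ≤ 12`, Galois if octic, Galois non-abelian-or-cyclic if dodecic»** — UNCONDITIONAL, no simplicity.
[cite: Gordon1999HodgeAVSurvey, Thm. 6.3–6.4] -/
theorem hcOnClass_isIsogenous_powSucc_cmField_finrank_le_twelve :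
    HCOnClass fun B ↦ ∃ (X : AbelianVariety ℂ) (N : ℕ) (F : Type) (_ : Field F) (_ : NumberField F)
      (_ : IsCMField F),
      Module.finrank ℚ F ≤ 12 ∧ (Module.finrank ℚ F = 8 → IsGalois ℚ F) ∧
      (Module.finrank ℚ F = 12 → IsGalois ℚ F ∧ ((∃ x y : F ≃ₐ[ℚ] F, x * y ≠ y * x) ∨ IsCyclic (F ≃ₐ[ℚ] F))) ∧
      Module.finrank ℚ F = 2 * X.dim ∧ Nonempty (F →+* X.endAlgebra) ∧ IsIsogenous B (X.powSucc N) := by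
  rintro B ⟨X, N, F, _, _, _, h12, hGal8, hGal12, hF, ⟨φ⟩, h⟩
  exact hodgeConjectureFor_of_isIsogenous_powSucc_of_finrank_le_twelve h12 hGal8 hGal12 φ hF h

/-- **HC on the class «isogenous to a power of an abelian FOURFOLD `X` with an octic CM field `F ↪ End⁰(X)` having
more than two automorphisms»** — UNCONDITIONAL, no simplicity. [cite: Dodson1984, §3.3.2 Theorem (p. 16)]
[cite: Gordon1999HodgeAVSurvey, 5.13 and Thm. 6.4] -/
theorem hcOnClass_isIsogenous_powSucc_fourfold_octicCM_two_lt_card :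
    HCOnClass fun B ↦ ∃ (X : AbelianVariety ℂ) (N : ℕ) (F : Type) (_ : Field F) (_ : NumberField F)
      (_ : IsCMField F),
      Module.finrank ℚ F = 8 ∧ 2 < Nat.card (F ≃ₐ[ℚ] F) ∧ Module.finrank ℚ F = 2 * X.dim ∧
      Nonempty (F →+* X.endAlgebra) ∧ IsIsogenous B (X.powSucc N) := by
  rintro B ⟨X, N, F, _, _, _, h8, hA, hF, ⟨φ⟩, h⟩
  exact (isStablyNondegenerate_of_two_lt_card h8 hA φ hF).hodgeConjectureFor_of_isIsogenous_powSucc h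

end Summit.HodgeConjecture.CorCM.SmallDegreeAllTypes

end
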